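import Summits.CriticalPhenomena.PercolationContinuityZ3.Theorems.Transplant.SkelFrmBChoiceGeom
import Summits.CriticalPhenomena.PercolationContinuityZ3.Theorems.Transplant.SkelFrmBParamsSchedA
import Summits.CriticalPhenomena.PercolationContinuityZ3.Theorems.Transplant.PlanarCells2LevelsS
import HarnessLib

/-!
# N2 (frames-only node `SamePDropOfSkeletonFrm₁`, OPEN), WAVE 1 ROOM ROWS, part (b) (lead g11 2026-08-23T01:23:05Z): THE WORLD ROWS `hWπ` / `hWpl` AND THE COLUMN
# VERTEX AT THE SCHEME OF RECORD — generic over hp-8 g40's `Skelφ.cellGeomSG₂bS G ψ P w₀ Λ b₀` / `faceDataSGS`, then at the (ζ″) cells `fcellsS` / schedule `schedOfS`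

The (C) residue `Skelφ.reachOblAtHNF_of_kgCorr` (p5-g15, SkelPhiCorridorKGResidue) and the (R) root leg read, besides the GEOMETRY rows (a) (`hΩball/hreg/hlastM/hdeep`, hp-8 g40)
and the K-G-prism planar numerics (c) (p5-g15), the WORLD rows of `Skelφ.real_rim_le_corrO` (KGExcess): `hWπ : ∀ b ∈ Γ.Ewv α x δ ∪ FD.Hfull a′ (x+δ) du, b ∈ B_G(w₀, Rw)`
and `hWpl : ∀ b ∈ …, ψ b ∈ Λ_{m′} + ctr`, and a column vertex `c₀` over the cell centre with its depth `D₀` (KGDepth's `hc₀ : c₀ ∈ B_G(w₀, D₀)`).  This file serves them: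
* §1 (generic, any `ψ`, any staggered cells `P : PCells2S`, any schedule `Λ`): `mem_graphBall_of_mem_Ewv₂bS`, **`mem_graphBall_of_mem_Ewv_Hfull₂bS`** (`hWπ` with
  `Rw := R` for any `R ≥ rB α x δ, rQ α (x+δ), ρ a′ (x+δ) du ·` — at run pairs these are the realised values `E = Erad (nQ α (x+δ))` of p5's `reach_radii_concSG₂NS`),
  **`ψ_mem_box_image_of_mem_Ewv_Hfull₂bS`** (`hWpl` with `m′ := 25·rmax`, `ctr := cenS (x+δ)` — p3-g15's `BtwNS_subset_box_image_tgt / Q_subset_box_image /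
  Hfull_subset_box_image`, PlanarCells2LevelsS); twins of N1's `mem_graphBall_of_mem_Ewv(_Hfull)₂` (SkelPhiNegReachExcess) and of the (f2) step of `real_rim_le_concSG₂b`;
* §2 (the (ζ″) cells, map slot `φ′`): the COLUMN VERTEX over the staggered centre **`NegB.colVS … y`** (`fineA (colVS y) = cenS y`, `colVS y ∈ VWin (Q y) (rQ a y)` for the
  schedule of record, `colVS y ∈ B_G(t, offNS y) ⊆ B_G(t, cOffS·(|y₀|+|y₁|) + 1)` — the (C)/(R) binders `c₀`, `hcF/hcQ/hcD`, KGDepth's `D₀`); twin of N1's `SkelNegBParamsColA`;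
  and `qSepGeom_fineA_bS` (the (C) residue's `hQ : QSepGeom` at the staggered cells, any schedule/boxes).
The RADIUS VALUE rows (`Pk.r₀ ≤ R`, `R₁ ≤ R − L′`, `D₀ + (kq+3)·‖z‖₁ ≤ R` on the prism, `cOffS ≤ gap`) are floors on the schedule slot `Sv` and ride in the numbers file
(`SkelFrmBChoiceNums`, FRM-PARAMS (r13-20)).
builds on p205010 (kernel theorem, internal audit signed; external expert review pending) — nothing in this file uses p205010; NOTHING is claimed about the open node
`SamePDropOfSkeletonFrm₁` (`SamePDropOfSkeletonNeg₁` is CLOSED in the tree and untouched by this file).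
Lane `prim-bschramm`, seat `prim-bschramm-stmt` (gen 20); helper file (`--supports stmt-CriticalPhenomena-4575 --as helper`); CLAIM 2026-08-23T01:27:05Z.
[cite: KozmaNitzan2024, §4 Lemma 12 (pp. 23–25), p. 26 ((29): columns), p. 31] [cite: MartineauTassion2017, §4.3]
-/

noncomputable section

open scoped Classical

namespace Summit.CriticalPhenomena.PercolationContinuityZ3.Theorems.Transplant

open Literature.Probability.Percolation Literature.Probability.LatticeModels SimpleGraph KNCells
open Literature.Barriers.CriticalPhenomena (graphBall graphBall_mono)
open BoxProdZ2 (ConcRadiiG)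

/-! ## §1 The world rows over `cellGeomSG₂bS` (generic) -/

namespace Skelφ

section World

variable {V : Type} [DecidableEq V] {G : SimpleGraph V} [G.LocallyFinite] {ψ : V → Site 2} {P : PCells2S} {w₀ : V} {Λ : ConcRadiiG} {b₀ : Fin 2 → ℕ}

/-- **`E_{v,x}` lies in the ball of radius `R`** (scheme `cellGeomSG₂bS`: the incoming between-box window has depth `rB α v δ`, the cube window of `x = v + δ` depth
`rQ α x`). [folklore] -/
theorem mem_graphBall_of_mem_Ewv₂bS {α : ℕ} {v : Site 2} {δ : MDir} {R : ℕ} (hB : Λ.rB α v δ ≤ R) (hQ : Λ.rQ α (v + stepVec δ) ≤ R)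
    {x : V} (hx : x ∈ (cellGeomSG₂bS G ψ P w₀ Λ b₀).Ewv α v δ) : x ∈ graphBall G w₀ R := by
  rw [CellGeom.Ewv] at hx
  rcases Finset.mem_union.1 hx with hx | hx
  · change x ∈ VWin G ψ w₀ (PCells2S.BtwNS P v δ) (Λ.rB α v δ) at hx
    exact graphBall_mono G w₀ hB (mem_graphBall_of_mem_VWin hx)
  · change x ∈ VWin G ψ w₀ (PCells2S.Q P (v + stepVec δ)) (Λ.rQ α (v + stepVec δ)) at hx
    exact graphBall_mono G w₀ hQ (mem_graphBall_of_mem_VWin hx)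

/-- **THE WORLD ROW `hWπ`: `E_{v,x} ∪ H_{x,du}` lies in the ball of radius `R`** (scheme `cellGeomSG₂bS`, face data `faceDataSGS`; the staircase profile of `H` is
`ρ a′ x du ·`). [cite: KozmaNitzan2024, §4 p. 31] -/
theorem mem_graphBall_of_mem_Ewv_Hfull₂bS {α β : ℕ} {v : Site 2} {δ du : MDir} {R : ℕ}
    (hB : Λ.rB α v δ ≤ R) (hQ : Λ.rQ α (v + stepVec δ) ≤ R) (hρ : ∀ ℓ, Λ.ρ β (v + stepVec δ) du ℓ ≤ R)
    {x : V} (hx : x ∈ (cellGeomSG₂bS G ψ P w₀ Λ b₀).Ewv α v δ ∪ (faceDataSGS G ψ P w₀ Λ).Hfull β (v + stepVec δ) du) : x ∈ graphBall G w₀ R := by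
  rcases Finset.mem_union.1 hx with hx | hx
  · exact mem_graphBall_of_mem_Ewv₂bS hB hQ hx
  · change x ∈ VStair G ψ w₀ (PCells2S.Hfull P (v + stepVec δ) du) (profS P Λ β (v + stepVec δ) du) at hx
    exact graphBall_mono G w₀ (hρ _) (mem_of_mem_VStair hx).2

/-- **THE WORLD ROW `hWpl`: planar footprints of `E_{v,x} ∪ H_{x,du}` lie in `cenS x + Λ_{25·rmax}`** (`x = v + δ`; the narrow arm `BtwNS v δ`, the cube `Q x` and the
habitat `Hfull x du` are all within 25 units of the target's STAGGERED centre). [cite: KozmaNitzan2024, §4 Lemma 12 (p. 24)] -/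
theorem ψ_mem_box_image_of_mem_Ewv_Hfull₂bS {α β : ℕ} {v : Site 2} {δ du : MDir}
    {x : V} (hx : x ∈ (cellGeomSG₂bS G ψ P w₀ Λ b₀).Ewv α v δ ∪ (faceDataSGS G ψ P w₀ Λ).Hfull β (v + stepVec δ) du) :
    ψ x ∈ (box 2 (25 * P.rmax)).image (fun s => s + PCells2S.cenS P (v + stepVec δ)) := by
  have hQimg : PCells2S.Q P (v + stepVec δ) ⊆ (box 2 (25 * P.rmax)).image (fun s => s + PCells2S.cenS P (v + stepVec δ)) :=
    (P.Q_subset_box_image _).trans (Finset.image_subset_image (box_mono 2 (by omega)))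
  rcases Finset.mem_union.1 hx with hx | hx
  · rw [CellGeom.Ewv] at hx
    rcases Finset.mem_union.1 hx with hx | hx
    · change x ∈ VWin G ψ w₀ (PCells2S.BtwNS P v δ) (Λ.rB α v δ) at hx
      exact P.BtwNS_subset_box_image_tgt v δ (φ_mem_of_mem_VWin hx)
    · change x ∈ VWin G ψ w₀ (PCells2S.Q P (v + stepVec δ)) (Λ.rQ α (v + stepVec δ)) at hx
      exact hQimg (φ_mem_of_mem_VWin hx)
  · change x ∈ VStair G ψ w₀ (PCells2S.Hfull P (v + stepVec δ) du) (profS P Λ β (v + stepVec δ) du) at hx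
    exact P.Hfull_subset_box_image _ _ (mem_of_mem_VStair hx).1

/-- The planar footprint of a cube vertex lies in `cenS y + Λ_{5·rmax}`. [folklore] -/
theorem ψ_mem_box_image_of_mem_Q₂bS {a : ℕ} {y : Site 2} {x : V} (hx : x ∈ (cellGeomSG₂bS G ψ P w₀ Λ b₀).Q a y) :
    ψ x ∈ (box 2 (5 * P.rmax)).image (fun s => s + PCells2S.cenS P y) := by
  change x ∈ VWin G ψ w₀ (PCells2S.Q P y) (Λ.rQ a y) at hx
  exact P.Q_subset_box_image _ (φ_mem_of_mem_VWin hx)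

/-- A cube vertex lies in the ball of the cube's radius. [folklore] -/
theorem mem_graphBall_of_mem_Q₂bS {a : ℕ} {y : Site 2} {x : V} (hx : x ∈ (cellGeomSG₂bS G ψ P w₀ Λ b₀).Q a y) : x ∈ graphBall G w₀ (Λ.rQ a y) := by
  change x ∈ VWin G ψ w₀ (PCells2S.Q P y) (Λ.rQ a y) at hx
  exact mem_graphBall_of_mem_VWin hx

/-- An arrival-box vertex lies in the ball of radius `rM` and maps into the small box `Mb b₀ y`. [folklore] -/
theorem mem_of_mem_M₂bS {a : ℕ} {y : Site 2} {x : V} (hx : x ∈ (cellGeomSG₂bS G ψ P w₀ Λ b₀).M a y) :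
    ψ x ∈ PCells2S.Mb P b₀ y ∧ x ∈ graphBall G w₀ (Λ.rM a y) := by
  rw [cellGeomSG₂bS_M] at hx
  exact ⟨φ_mem_of_mem_VWin hx, mem_graphBall_of_mem_VWin hx⟩

end World

end Skelφ

/-! ## §2 The column vertex over the staggered centre (the (ζ″) cells, map slot `φ′`) -/

namespace PlanarSkeletonFrm

namespace NegB

open SkelConc (Consts)
open Neg

section Col

variable (κ : Consts) {V : Type} [DecidableEq V] [Countable V] {G : SimpleGraph V} [G.LocallyFinite] (Φ : PlanarSkeletonFrm G) (t : V)
  (p : unitInterval) (D : Skelφ.StepI.DataNS V) (g f : ℕ) (c : Fin 2 → ℕ) {φ' : V → Site 2}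

/-- **THE COLUMN VERTEX OVER THE STAGGERED CENTRE**: a vertex of fine position exactly `cenS y`, inside the cube window of radius `offNS y = NrepA (cenS y) + 1` (chosen
from `hcol_fineA_atS`). [cite: KozmaNitzan2024, §4 p. 26 ((29): columns)] -/
def colVS (hlip : Skelφ.Lip G φ') (hstep : Skelφ.Steps G φ') (hN : EqNumL κ Φ t p D g f) (y : Site 2) : V :=
  Classical.choose (hcol_fineA_atS κ Φ t p D g f c hlip hstep hN y (le_refl (offNS κ Φ t p D g f c y)))

/-- The column vertex's defining facts. [folklore] -/
theorem colVS_spec (hlip : Skelφ.Lip G φ') (hstep : Skelφ.Steps G φ') (hN : EqNumL κ Φ t p D g f) (y : Site 2) :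
    colVS κ Φ t p D g f c hlip hstep hN y ∈ Skelφ.VWin G (fineA κ Φ t p D g f φ') t ((fcellsS κ Φ t p D g f c).Q y) (offNS κ Φ t p D g f c y) ∧
      fineA κ Φ t p D g f φ' (colVS κ Φ t p D g f c hlip hstep hN y) = (fcellsS κ Φ t p D g f c).cenS y :=
  (Classical.choose_spec (hcol_fineA_atS κ Φ t p D g f c hlip hstep hN y (le_refl (offNS κ Φ t p D g f c y))))

/-- **`fineA (colVS y) = cenS y`** (the (C)/(R) binder `hcF`). [folklore] -/
theorem colVS_eq (hlip : Skelφ.Lip G φ') (hstep : Skelφ.Steps G φ') (hN : EqNumL κ Φ t p D g f) (y : Site 2) :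
    fineA κ Φ t p D g f φ' (colVS κ Φ t p D g f c hlip hstep hN y) = (fcellsS κ Φ t p D g f c).cenS y :=
  (colVS_spec κ Φ t p D g f c hlip hstep hN y).2

/-- The column vertex lies in every cube window of radius `≥ offNS y`. [folklore] -/
theorem colVS_mem_VWin (hlip : Skelφ.Lip G φ') (hstep : Skelφ.Steps G φ') (hN : EqNumL κ Φ t p D g f) (y : Site 2) {R : ℕ}
    (hR : offNS κ Φ t p D g f c y ≤ R) :
    colVS κ Φ t p D g f c hlip hstep hN y ∈ Skelφ.VWin G (fineA κ Φ t p D g f φ') t ((fcellsS κ Φ t p D g f c).Q y) R :=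
  Skelφ.VWin_mono (subset_refl _) hR (colVS_spec κ Φ t p D g f c hlip hstep hN y).1

/-- **The column vertex lies in the cube window of the schedule of record at every anchor** (the (C)/(R) binder `hcQ`; `colQ_schedOfS`). [folklore] -/
theorem colVS_mem_VWin_schedOfS (hlip : Skelφ.Lip G φ') (hstep : Skelφ.Steps G φ') (hN : EqNumL κ Φ t p D g f) (S : Skelφ.Prm.SchedIn) (a : ℕ) (y : Site 2) :
    colVS κ Φ t p D g f c hlip hstep hN y ∈
      Skelφ.VWin G (fineA κ Φ t p D g f φ') t ((fcellsS κ Φ t p D g f c).Q y) ((schedOfS κ Φ t p D g f c S).rQ a y) :=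
  colVS_mem_VWin κ Φ t p D g f c hlip hstep hN y (colQ_schedOfS κ Φ t p D g f c S a y)

/-- **The column vertex's depth** `colVS y ∈ B_G(t, offNS y)`. [folklore] -/
theorem colVS_mem_graphBall (hlip : Skelφ.Lip G φ') (hstep : Skelφ.Steps G φ') (hN : EqNumL κ Φ t p D g f) (y : Site 2) :
    colVS κ Φ t p D g f c hlip hstep hN y ∈ graphBall G t (offNS κ Φ t p D g f c y) :=
  Skelφ.mem_graphBall_of_mem_VWin (colVS_spec κ Φ t p D g f c hlip hstep hN y).1

/-- **THE COLUMN VERTEX'S DEPTH IS LINEAR IN THE CELL INDEX** (the (C)/(R) binder `hcD` with `cC := cOffS`, `dC := 1`; KGDepth's `D₀`):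
`colVS y ∈ B_G(t, cOffS·(|y₀| + |y₁|) + 1)`, under the numeric long clause and `|h_L| ≤ 10·n_L`. [cite: KozmaNitzan2024, §4 Lemma 10 Step IV (pp. 20–21)] -/
theorem colVS_mem_graphBall_lin (hlip : Skelφ.Lip G φ') (hstep : Skelφ.Steps G φ') (hN : EqNumL κ Φ t p D g f)
    (hκ : (hL κ Φ t p D g f).natAbs ≤ 10 * nL κ Φ t p D g f) (y : Site 2) :
    colVS κ Φ t p D g f c hlip hstep hN y ∈ graphBall G t (cOffS κ Φ t p D g f * ((y 0).natAbs + (y 1).natAbs) + 1) :=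
  graphBall_mono G t (offNS_le κ Φ t p D g f c hN hκ y) (colVS_mem_graphBall κ Φ t p D g f c hlip hstep hN y)

/-- **`QSepGeom` for the staggered cells at the fine map of record** (any schedule, any boxes): the (C) residue's `hQ` at `NegB.ΓQ` (with `φ′ := φL …`, `D := O.merged`,
`hN := eqNumL_of_atQ hAt`). [cite: KozmaNitzan2024, §4 p. 26 ((29))] -/
theorem qSepGeom_fineA_bS (hlip : Skelφ.Lip G φ') (hN : EqNumL κ Φ t p D g f) (Λ : ConcRadiiG) (b₀ : Fin 2 → ℕ) :
    QSepGeom G (Skelφ.cellGeomSG₂bS G (fineA κ Φ t p D g f φ') (fcellsS κ Φ t p D g f c) t Λ b₀) :=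
  Skelφ.qSepGeomSG₂bS _ _ _ (lip_fineA_at κ Φ t p D g f hlip hN)

end Col

end NegB

end PlanarSkeletonFrm

end Summit.CriticalPhenomena.PercolationContinuityZ3.Theorems.Transplant

end
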